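import Summits.CriticalPhenomena.PercolationContinuityZ3.Theorems.PercNearOneGluingNoHeavyLowerTailFKPhiMassDefs
import Summits.CriticalPhenomena.PercolationContinuityZ3.Theorems.PercNearOneGluingNoHeavyLowerTailFKCSHPhiNonneg
import Summits.CriticalPhenomena.PercolationContinuityZ3.Theorems.PercNearOneGluingNoHeavyLowerTailFKCSHUnfoldDecoy
import HarnessLib

/-!
# FK sub-lane: `Φ_FK = phiMass / zMass` — the bridge from `FK.phiFK` to the mass-level objects

Support file (`--supports stmt-CriticalPhenomena-4575`), FK sub-lane `prim-bschramm-fk-2` (gen 4); builds on p205010 (kernel theorem,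
internal audit signed; external expert review pending).  No definitions, no named facts, no sorries; standard axioms.

* `FK.phiFK_eq_sum_phiD`, **`FK.phiFK_eq_div : phiFK w q x Y g K = phiMass w q x Y g K / zMass w q K`**, `FK.phiMass_eq_mul`;
* `FK.zMass_pos`, `FK.phiMass_nonneg` (`q ≥ 1`, from fk-1's `FK.phiFK_nonneg`), `FK.phiMass_of_mem` (`x ∈ Y ⇒ Φ = 0`).
First file of fk-2 gen 4's proof of `FK.PhiFKMonotone q` (bschramm/FK-Q2.md §13).
[cite: VandenbergHaggstromKahn2005, §2.1 eq. (11), Lemma 2.3 (p. 10)] [cite: Grimmett2006, §1.4 eq. (1.20) (p. 15)]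
-/

noncomputable section

namespace Summit.CriticalPhenomena.PercolationContinuityZ3.Theorems.FK

open MeasureTheory Set Literature.Probability.LatticeModels Literature.Probability.Percolation
open Literature.Probability.Percolation.DecisionTree (ind ind_of_mem ind_of_not_mem ind_nonneg)
open Literature.Probability.Percolation.BHK2006 (rcMass rcMass_nonneg delW setIntegral_rcMeasureW_eq_sum integral_rcMeasureW_eq_sum)
open Summit.CriticalPhenomena.PercolationContinuityZ3.Theorems.HullPort (cut avoidEv)
open scoped Classical

variable {V : Type*} [Fintype V]

/-- The partition function of `G − K̄` is positive (`q > 0`). [cite: Grimmett2006, §1.4 eq. (1.20) (p. 15)] -/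
theorem zMass_pos (w : Sym2 V → unitInterval) {q : ℝ} (hq : 0 < q) (K : Set V) : 0 < zMass w q K :=
  rcPartitionFunctionW_pos _ hq ∅

/-- **`Φ_FK = phiMass / zMass`**: the residual functional of the unfolding for `φ_{w,q}` is the ratio of the unnormalised `Φ`-mass
and the partition function of `G − K̄` (`q > 0`). [cite: VandenbergHaggstromKahn2005, §2.1 eq. (11) (p. 9)] [cite: Grimmett2006, §1.4 eq. (1.20) (p. 15)] -/
theorem phiFK_eq_div (w : Sym2 V → unitInterval) {q : ℝ} (hq : 0 < q) (x : V) (Y : Set V) (g : Set (Sym2 V) → ℝ)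
    (K : Set V) : phiFK w q x Y g K = phiMass w q x Y g K / zMass w q K := by
  unfold phiFK phiMass zMass
  have hD : {ω : BondConfig V | ∀ y ∈ Y, ¬ (openGraph ω).Reachable x y} = avoidEv x Y := rfl
  rw [hD, setIntegral_rcMeasureW_eq_sum _ hq, Finset.sum_div]
  refine Finset.sum_congr rfl fun ω _ => ?_
  rw [worldMeanY_eq_wE w hq]
  unfold phiD rcMass
  ring

/-- `phiMass = Φ_FK · zMass`. [cite: Grimmett2006, §1.4 eq. (1.20) (p. 15)] -/
theorem phiMass_eq_mul (w : Sym2 V → unitInterval) {q : ℝ} (hq : 0 < q) (x : V) (Y : Set V) (g : Set (Sym2 V) → ℝ)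
    (K : Set V) : phiMass w q x Y g K = phiFK w q x Y g K * zMass w q K := by
  rw [phiFK_eq_div w hq, div_mul_cancel₀ _ (zMass_pos w hq K).ne']

/-- **`phiMass ≥ 0` for `q ≥ 1`** (fk-1's `FK.phiFK_nonneg`: domination in `𝐩`). [cite: Grimmett2006, Thm. (3.21) (p. 44)] -/
theorem phiMass_nonneg (w : Sym2 V → unitInterval) {q : ℝ} (hq : 1 ≤ q) (x : V) (Y : Set V) {g : Set (Sym2 V) → ℝ}
    (hg : Monotone g) (K : Set V) : 0 ≤ phiMass w q x Y g K := by
  rw [phiMass_eq_mul w (one_pos.trans_le hq)]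
  exact mul_nonneg (phiFK_nonneg w hq x Y hg K) (zMass_pos w (one_pos.trans_le hq) K).le

omit [Fintype V] in
/-- `x ∈ Y` ⇒ the avoidance event `{x ↮ Y}` is empty. [folklore] -/
theorem ind_avoidEv_of_mem {x : V} {Y : Set V} (hx : x ∈ Y) (ω : Set (Sym2 V)) : ind (avoidEv x Y) ω = 0 :=
  ind_of_not_mem fun h => h x hx (SimpleGraph.Reachable.refl x)

/-- `x ∈ Y` ⇒ `phiD ≡ 0`. [folklore] -/
theorem phiD_of_mem (w : Sym2 V → unitInterval) (q : ℝ) {x : V} {Y : Set V} (hx : x ∈ Y) (g : Set (Sym2 V) → ℝ)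
    (ω : Set (Sym2 V)) : phiD w q x Y g ω = 0 := by
  unfold phiD; rw [ind_avoidEv_of_mem hx, zero_mul]

/-- `x ∈ Y` ⇒ `phiMass = 0`. [folklore] -/
theorem phiMass_of_mem (w : Sym2 V → unitInterval) (q : ℝ) {x : V} {Y : Set V} (hx : x ∈ Y) (g : Set (Sym2 V) → ℝ)
    (K : Set V) : phiMass w q x Y g K = 0 :=
  Finset.sum_eq_zero fun ω _ => by rw [phiD_of_mem w q hx, mul_zero]

/-- **`Φ_FK` as the `φ_{G−K̄}`-mean of `phiD`**: `phiFK w q x Y g K = Σ_ω φ_{w−K̄}(ω)·phiD(ω)`.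
[cite: VandenbergHaggstromKahn2005, §2.1 eq. (11), Lemma 2.3 (p. 10)] -/
theorem phiFK_eq_sum_phiD (w : Sym2 V → unitInterval) {q : ℝ} (hq : 0 < q) (x : V) (Y : Set V) (g : Set (Sym2 V) → ℝ) (K : Set V) :
    phiFK w q x Y g K = ∑ ω, rcMass (delW w (CSH.edgesOf K)) q ω * phiD w q x Y g ω := by
  unfold phiFK
  have hD : {ω : BondConfig V | ∀ y ∈ Y, ¬ (openGraph ω).Reachable x y} = avoidEv x Y := rfl
  rw [hD, setIntegral_rcMeasureW_eq_sum _ hq]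
  refine Finset.sum_congr rfl fun ω _ => ?_
  rw [worldMeanY_eq_wE w hq]
  unfold phiD
  ring

end Summit.CriticalPhenomena.PercolationContinuityZ3.Theorems.FK

end
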